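import Mathlib
import HarnessLib
import Literature.Probability.LatticeModels.RandomClusterIsoInvariance
import Literature.Probability.LatticeModels.RandomClusterShiftedBoxes
import Literature.Probability.LatticeModels.CriticalFKIsingArmVanishes
import Literature.Probability.LatticeModels.PlusDomainCorr
import Literature.Probability.Percolation.SiteConnectionTools
import Literature.Analysis.FluidPDE.OctahedralSymmetry

/-!
# Point-group invariance of the random-cluster connection laws on boxes of `ℤ^d`, and of their
# scaling limits

Topic `Literature/Probability/LatticeModels`. The automorphism group of `ℤ^d` fixing the origin is
the hyperoctahedral group `B_d` of the `2^d · d!` signed coordinate permutations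
`σ = Site.signedPerm π ε : x ↦ (i ↦ ε i * x (π⁻¹ i))` (`SiteConnectionTools`: `zdSignedPermIso`);
each maps every box `Λ_L = [-L, L]^d` onto itself (`signedPerm_mem_box_iff`). By the invariance of
the finite-volume random-cluster measures under graph isomorphisms (Grimmett 2006, §4.3;
`RandomClusterIsoInvariance`: `rcMeasure_real_preimage_relabel`, `finsetGraphIso`,
`image_finsetGraphIso_wiredBoundary`) the wired measures `φ¹_{Λ_L,p,q}` are therefore EXACTLY
invariant under `B_d`, box by box. This file records that invariance for the laws of the OPEN-PATH
CONNECTION RELATION among finitely many probe sets `K i ⊆ ℤ^d` (`i ~ j` iff some `x ∈ K i`,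
`y ∈ K j` in the box are joined by an open path of the box; the events of
`CriticalFKIsingConnectionLaws`), and transfers it to scaling limits:

* `connRel_relabel_finsetGraphIso` — transport of the connection relation along a lattice
  automorphism restricted to finite pieces (`reachable_relabel_graphIso_iff`);
* `rcMeasure_real_connRelLaw_iso` — for an automorphism `g` of `ℤ^d` with `g(S) = S'`:
  `φ¹_{S'}(rel_{g K} ∈ R) = φ¹_S(rel_K ∈ R)`, where `(g K) i = {x | g⁻¹ x ∈ K i}`;
* `rcMeasure_real_connRelLaw_box_signedPerm` — for `σ ∈ B_d` and EVERY `L`: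
  `φ¹_{Λ_L}(rel_{σ K} ∈ R) = φ¹_{Λ_L}(rel_K ∈ R)`; hence the `L → ∞` behaviour is identical
  (`tendsto_rcMeasure_real_connRelLaw_box_signedPerm_iff`) and in particular the `limUnder` values
  agree whether or not the limit exists (`limUnder_rcMeasure_real_connRelLaw_box_signedPerm`) — the
  point-group half of the automorphism invariance of the wired limit, Grimmett 2006, Thm. (4.19)(b),
  for these functionals (the translation half needs the limit: `CriticalFKIsingConnectionLaws`);
* the continuum side: `σ` extends to the linear isometry `A = signedPermIsometry π⁻¹ ε` of `ℝ^d`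
  (`OctahedralSymmetry`), compatibly with the mesh embedding `meshPos δ z = δ z`
  (`signedPermIsometry_meshPos : A (δ z) = δ (σ z)`); a linear isometry acts on GENERALISED BALLS —
  data `(c, r)`: the closed ball `B̄(c, r)` for `r > 0`, the closed exterior `ℝ^d ∖ B(c, -r)`
  otherwise — through their data (`isometry_mem_genBall_iff`), so the mesh-`δ` discretisation of
  the generalised ball with data `(A c, r)` IS the `σ`-transport of that with data `(c, r)`
  (`disc_genBall_map_eq_of_meshPos`);
* `scalingLimit_map_eq_of_latticeSymmetry` — the glue: for ANY functional `P` of `m`-tuples of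
  lattice sets invariant under `K ↦ σ K`, any full-filter limit `lam p` of `P` of the mesh-`δ`
  discretised generalised balls with data `p` along `δ → 0⁺` satisfies `lam (A c, r)ᵢ = lam (c, r)ᵢ`
  (the two `δ`-families coincide; limits along `𝓝[>] 0` are unique);
  `scalingLimit_signedPermIsometry_eq` specialises to `B_d`, and
  `connRelLaw_scalingLimit_signedPermIsometry_eq` to `P K = limUnder_L φ¹_{Λ_L,p,q}(rel_K ∈ R)`:
  every full-filter scaling limit of the wired box connection laws of the random-cluster model on
  `ℤ^d` is `B_d`-invariant (`0 ≤ p ≤ 1`, `0 < q`; no existence statement is made or needed).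

Written for the route `CriticalPhenomena/Ising3DConformalLimit/ArmDressing` (crux
`BallConnectivityMoebius`, whose clause (O) asks for invariance under ALL of `O(3)` — isotropy, open
in `d = 3`; this file is the exact lattice-symmetric part). Generalised balls and discretisations
are written out (`if 0 < r then Metric.closedBall c r else (Metric.ball c (-r))ᶜ`,
`{x | meshPos δ x ∈ U}`), no new definitions. Everything is proved; no named facts.

## References

* G. Grimmett, *The Random-Cluster Model*, Springer 2006: §4.3 (invariance under automorphisms),
  Thm. (4.19)(b). [Grimmett2006]
-/

noncomputable section

namespace Literature.Probability.LatticeModels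

open _root_.MeasureTheory Filter _root_.Topology SimpleGraph
open Literature.Probability.Percolation Literature.Analysis.FluidPDE

variable {d : ℕ}

/-! ### The lattice side: automorphism invariance of the wired connection laws -/

section Lattice

/-- **Transport of the connection relation along a lattice automorphism.** For an automorphism
`g` of `ℤ^d` with `g(S) = S'`, the restricted isomorphism `ψ = finsetGraphIso g hS : S ≃g S'` and a
configuration `ω` on `S`, the open-path connection relation of the relabelled configuration `ψ ω`
among the probes `{x | g⁻¹ x ∈ K i}` (read in `S'`) is the connection relation of `ω` among the
probes `K i` (read in `S`): open paths are transported by `ψ`. [folklore] -/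
theorem connRel_relabel_finsetGraphIso (g : zdGraph d ≃g zdGraph d) {S S' : Finset (Site d)}
    (hS : ∀ x, x ∈ S' ↔ g.symm x ∈ S) {m : ℕ} (K : Fin m → Set (Site d)) (ω : BondConfig ↥S) :
    (fun i j => ∃ x y : ↥S', g.symm x.1 ∈ K i ∧ g.symm y.1 ∈ K j ∧
        (openGraph (BondConfig.relabel (sym2Equiv (finsetGraphIso g hS).toEquiv) ω)).Reachable
          x y) =
      (fun i j => ∃ x y : ↥S, x.1 ∈ K i ∧ y.1 ∈ K j ∧ (openGraph ω).Reachable x y) := by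
  funext i j
  refine propext ⟨?_, ?_⟩
  · rintro ⟨x, y, hx, hy, hxy⟩
    refine ⟨(finsetGraphIso g hS).symm x, (finsetGraphIso g hS).symm y, hx, hy, ?_⟩
    rw [← reachable_relabel_graphIso_iff (finsetGraphIso g hS) ω]
    simpa using hxy
  · rintro ⟨x, y, hx, hy, hxy⟩
    refine ⟨finsetGraphIso g hS x, finsetGraphIso g hS y, ?_, ?_, ?_⟩
    · simpa using hx
    · simpa using hy
    · exact (reachable_relabel_graphIso_iff (finsetGraphIso g hS) ω x y).2 hxy

/-- **Automorphism invariance of the wired connection laws** (Grimmett 2006, §4.3): for an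
automorphism `g` of `ℤ^d` with `g(S) = S'`, `0 ≤ p ≤ 1`, `0 < q`, probes `K i ⊆ ℤ^d` and a set `R`
of relations on the indices, the `∂S'`-wired random-cluster probability on `S'` that the open-path
connection relation among the transported probes `{x | g⁻¹ x ∈ K i}` lies in `R` equals the
`∂S`-wired probability on `S` that the connection relation among the `K i` lies in `R`. Proof: the
measure is carried by `ψ = finsetGraphIso g hS` (`rcMeasure_real_preimage_relabel`), `ψ(∂S) = ∂S'`
(`image_finsetGraphIso_wiredBoundary`), and the event pulls back by
`connRel_relabel_finsetGraphIso`. [cite: Grimmett2006, §4.3] -/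
theorem rcMeasure_real_connRelLaw_iso (g : zdGraph d ≃g zdGraph d) {S S' : Finset (Site d)}
    (hS : ∀ x, x ∈ S' ↔ g.symm x ∈ S) {p q : ℝ} (hp : p ∈ Set.Icc (0 : ℝ) 1) (hq : 0 < q)
    {m : ℕ} (K : Fin m → Set (Site d)) (R : Set (Fin m → Fin m → Prop)) :
    (rcMeasure (finsetGraph (zdGraph d) S') p q (wiredBoundary (zdGraph d) S')).real
        {ω | (fun i j => ∃ x y : ↥S', g.symm x.1 ∈ K i ∧ g.symm y.1 ∈ K j ∧
          (openGraph ω).Reachable x y) ∈ R} =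
      (rcMeasure (finsetGraph (zdGraph d) S) p q (wiredBoundary (zdGraph d) S)).real
        {ω | (fun i j => ∃ x y : ↥S, x.1 ∈ K i ∧ y.1 ∈ K j ∧ (openGraph ω).Reachable x y) ∈ R} := by
  rw [← image_finsetGraphIso_wiredBoundary g hS,
    ← rcMeasure_real_preimage_relabel (finsetGraphIso g hS) hp hq]
  congr 1
  ext ω
  simp only [Set.mem_preimage, Set.mem_setOf_eq]
  rw [connRel_relabel_finsetGraphIso g hS K ω]

/-- **Point-group invariance of the wired box connection laws.** A signed coordinate permutation
`σ = Site.signedPerm π ε` maps every box `Λ_L = [-L, L]^d` onto itself (and `∂Λ_L` onto itself), so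
for the `∂Λ_L`-wired random-cluster measure of `Λ_L` (`0 ≤ p ≤ 1`, `0 < q`) the probability that the
open-path connection relation among the probes `(σ K) i = {x | σ⁻¹ x ∈ K i}` lies in `R` equals that
for the probes `K i` — for EVERY `L` and every probe family. [cite: Grimmett2006, §4.3] -/
theorem rcMeasure_real_connRelLaw_box_signedPerm (π : Equiv.Perm (Fin d)) (ε : Fin d → ℤˣ)
    {p q : ℝ} (hp : p ∈ Set.Icc (0 : ℝ) 1) (hq : 0 < q) {m : ℕ} (K : Fin m → Set (Site d))
    (R : Set (Fin m → Fin m → Prop)) (L : ℕ) :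
    (rcMeasure (finsetGraph (zdGraph d) (box d L)) p q (wiredBoundary (zdGraph d) (box d L))).real
        {ω | (fun i j => ∃ x y : ↥(box d L), x.1 ∈ {z | (Site.signedPerm π ε).symm z ∈ K i} ∧
          y.1 ∈ {z | (Site.signedPerm π ε).symm z ∈ K j} ∧ (openGraph ω).Reachable x y) ∈ R} =
      (rcMeasure (finsetGraph (zdGraph d) (box d L)) p q (wiredBoundary (zdGraph d) (box d L))).real
        {ω | (fun i j => ∃ x y : ↥(box d L), x.1 ∈ K i ∧ y.1 ∈ K j ∧
          (openGraph ω).Reachable x y) ∈ R} :=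
  rcMeasure_real_connRelLaw_iso (zdSignedPermIso π ε) (mem_box_iff_signedPerm_symm_mem π ε L) hp hq K R

/-- Hence the two box sequences have the same limits: `φ¹_{Λ_L}(rel_{σ K} ∈ R) → ℓ` iff
`φ¹_{Λ_L}(rel_K ∈ R) → ℓ` as `L → ∞` (they agree term by term). [cite: Grimmett2006, Thm. (4.19)(b)] -/
theorem tendsto_rcMeasure_real_connRelLaw_box_signedPerm_iff (π : Equiv.Perm (Fin d))
    (ε : Fin d → ℤˣ) {p q : ℝ} (hp : p ∈ Set.Icc (0 : ℝ) 1) (hq : 0 < q) {m : ℕ}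
    (K : Fin m → Set (Site d)) (R : Set (Fin m → Fin m → Prop)) (l : Filter ℝ) :
    Tendsto (fun L : ℕ => (rcMeasure (finsetGraph (zdGraph d) (box d L)) p q
        (wiredBoundary (zdGraph d) (box d L))).real
        {ω | (fun i j => ∃ x y : ↥(box d L), x.1 ∈ {z | (Site.signedPerm π ε).symm z ∈ K i} ∧
          y.1 ∈ {z | (Site.signedPerm π ε).symm z ∈ K j} ∧ (openGraph ω).Reachable x y) ∈ R})
        atTop l ↔
      Tendsto (fun L : ℕ => (rcMeasure (finsetGraph (zdGraph d) (box d L)) p q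
        (wiredBoundary (zdGraph d) (box d L))).real
        {ω | (fun i j => ∃ x y : ↥(box d L), x.1 ∈ K i ∧ y.1 ∈ K j ∧
          (openGraph ω).Reachable x y) ∈ R}) atTop l := by
  rw [funext fun L => rcMeasure_real_connRelLaw_box_signedPerm π ε hp hq K R L]

/-- **The point-group half of Grimmett 2006, Thm. (4.19)(b), for the connection laws, limit or no
limit**: the `limUnder` (thermodynamic-limit) values of `L ↦ φ¹_{Λ_L,p,q}(rel_K ∈ R)` are unchanged
when every probe is transported by the same signed coordinate permutation `σ` — the two sequences
are equal, so even the junk values (no convergence) agree. [cite: Grimmett2006, Thm. (4.19)(b)] -/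
theorem limUnder_rcMeasure_real_connRelLaw_box_signedPerm (π : Equiv.Perm (Fin d))
    (ε : Fin d → ℤˣ) {p q : ℝ} (hp : p ∈ Set.Icc (0 : ℝ) 1) (hq : 0 < q) {m : ℕ}
    (K : Fin m → Set (Site d)) (R : Set (Fin m → Fin m → Prop)) :
    limUnder atTop (fun L : ℕ => (rcMeasure (finsetGraph (zdGraph d) (box d L)) p q
        (wiredBoundary (zdGraph d) (box d L))).real
        {ω | (fun i j => ∃ x y : ↥(box d L), x.1 ∈ {z | (Site.signedPerm π ε).symm z ∈ K i} ∧
          y.1 ∈ {z | (Site.signedPerm π ε).symm z ∈ K j} ∧ (openGraph ω).Reachable x y) ∈ R}) =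
      limUnder atTop (fun L : ℕ => (rcMeasure (finsetGraph (zdGraph d) (box d L)) p q
        (wiredBoundary (zdGraph d) (box d L))).real
        {ω | (fun i j => ∃ x y : ↥(box d L), x.1 ∈ K i ∧ y.1 ∈ K j ∧
          (openGraph ω).Reachable x y) ∈ R}) :=
  congrArg (limUnder atTop) (funext fun L => rcMeasure_real_connRelLaw_box_signedPerm π ε hp hq K R L)

end Lattice

/-! ### The continuum side: signed permutations as isometries of `ℝ^d`, generalised balls -/

section Continuum

/-- **The lattice symmetry extends to the isometry at every mesh**: for the signed permutation
isometry `A = signedPermIsometry π⁻¹ ε` of `ℝ^d` (`(A v) i = ε i * v (π⁻¹ i)`, `OctahedralSymmetry`)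
and `σ = Site.signedPerm π ε` (same formula on `ℤ^d`), `A (δ z) = δ (σ z)` where `δ z = meshPos δ z`.
[folklore] -/
theorem signedPermIsometry_meshPos (π : Equiv.Perm (Fin d)) (ε : Fin d → ℤˣ) (δ : ℝ) (z : Site d) :
    signedPermIsometry π.symm ε (meshPos δ z) = meshPos δ (Site.signedPerm π ε z) := by
  ext i
  simp only [signedPermIsometry_apply, meshPos_apply, Site.signedPerm_apply]
  push_cast
  ring

/-- **Isometries act on generalised balls through their data.** For a linear isometry `A` of a
real normed space, `A y` lies in the generalised ball with data `(A c, r)` — the closed ball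
`B̄(A c, r)` if `r > 0`, the closed exterior of the open ball `B(A c, -r)` otherwise — iff `y` lies
in the generalised ball with data `(c, r)` (`dist (A y) (A c) = dist y c`). [folklore] -/
theorem isometry_mem_genBall_iff {E : Type*} [NormedAddCommGroup E] [NormedSpace ℝ E]
    (A : E ≃ₗᵢ[ℝ] E) (y : E) (q : E × ℝ) :
    (A y ∈ (if 0 < q.2 then Metric.closedBall (A q.1) q.2 else (Metric.ball (A q.1) (-q.2))ᶜ)) ↔
      (y ∈ (if 0 < q.2 then Metric.closedBall q.1 q.2 else (Metric.ball q.1 (-q.2))ᶜ)) := by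
  split_ifs <;> simp [Metric.mem_closedBall, Metric.mem_ball, LinearIsometryEquiv.dist_map]

/-- **The exact lattice identity.** If a bijection `A` of `ℝ^d` extends the bijection `σ` of `ℤ^d`
at mesh `δ` (`A (δ z) = δ (σ z)`) and acts on generalised balls through their data, then the
mesh-`δ` discretisation `{x | δ x ∈ ·}` of the generalised ball with data `(A c, r)` is the
`σ`-transport `{x | σ⁻¹ x ∈ ·}` of the discretisation of the generalised ball with data `(c, r)` —
for a linear isometry `A`, both signs of `r`. [folklore] -/
theorem disc_genBall_map_eq_of_meshPos (σ : Site d ≃ Site d)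
    (A : EuclideanSpace ℝ (Fin d) ≃ₗᵢ[ℝ] EuclideanSpace ℝ (Fin d))
    (hA : ∀ z : Site d, ∀ δ : ℝ, A (meshPos δ z) = meshPos δ (σ z)) (δ : ℝ)
    (q : EuclideanSpace ℝ (Fin d) × ℝ) :
    {x : Site d | meshPos δ x ∈
        (if 0 < q.2 then Metric.closedBall (A q.1) q.2 else (Metric.ball (A q.1) (-q.2))ᶜ)} =
      {x : Site d | σ.symm x ∈ {y : Site d | meshPos δ y ∈
        (if 0 < q.2 then Metric.closedBall q.1 q.2 else (Metric.ball q.1 (-q.2))ᶜ)}} := by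
  ext x
  simp only [Set.mem_setOf_eq]
  rw [← isometry_mem_genBall_iff A _ q, hA, Equiv.apply_symm_apply]

/-- **Isometry invariance of a scaling limit from a lattice symmetry** (the glue). Let `σ` be a
bijection of `ℤ^d` and `A` a linear isometry of `ℝ^d` extending it at every mesh
(`A (δ z) = δ (σ z)`), and let `P` be ANY functional of `m`-tuples of lattice sets invariant under
the transport `K ↦ (fun i => {x | σ⁻¹ x ∈ K i})`. If `P` of the mesh-`δ` discretisations of the
generalised balls with data `p = (cᵢ, rᵢ)ᵢ` converges along `δ → 0⁺` to `lam p` at every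
nonzero-radius configuration, then `lam (A cᵢ, rᵢ)ᵢ = lam (cᵢ, rᵢ)ᵢ`: by
`disc_genBall_map_eq_of_meshPos` and the invariance of `P` the two `δ`-families of `P`-values
coincide, and limits along `𝓝[>] 0` are unique. No existence or continuity statement is involved
beyond the hypothesis. [folklore] -/
theorem scalingLimit_map_eq_of_latticeSymmetry {m : ℕ} (P : (Fin m → Set (Site d)) → ℝ)
    (σ : Site d ≃ Site d) (A : EuclideanSpace ℝ (Fin d) ≃ₗᵢ[ℝ] EuclideanSpace ℝ (Fin d))
    (hA : ∀ z : Site d, ∀ δ : ℝ, A (meshPos δ z) = meshPos δ (σ z))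
    (hP : ∀ K : Fin m → Set (Site d), P (fun i => {x | σ.symm x ∈ K i}) = P K)
    (lam : (Fin m → EuclideanSpace ℝ (Fin d) × ℝ) → ℝ)
    (hlim : ∀ p : Fin m → EuclideanSpace ℝ (Fin d) × ℝ, (∀ i, (p i).2 ≠ 0) →
      Tendsto (fun δ : ℝ => P (fun i => {x : Site d | meshPos δ x ∈
        (if 0 < (p i).2 then Metric.closedBall (p i).1 (p i).2
          else (Metric.ball (p i).1 (-(p i).2))ᶜ)})) (𝓝[>] 0) (𝓝 (lam p)))
    (p : Fin m → EuclideanSpace ℝ (Fin d) × ℝ) (hp : ∀ i, (p i).2 ≠ 0) :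
    lam (fun i => (A (p i).1, (p i).2)) = lam p := by
  -- the `δ`-family at the transformed configuration IS the family of the `σ`-transported sets …
  have h1 : Tendsto (fun δ : ℝ => P (fun i => {x : Site d | σ.symm x ∈ {y : Site d | meshPos δ y ∈
        (if 0 < (p i).2 then Metric.closedBall (p i).1 (p i).2
          else (Metric.ball (p i).1 (-(p i).2))ᶜ)}})) (𝓝[>] 0)
      (𝓝 (lam (fun i => (A (p i).1, (p i).2)))) := by
    refine (hlim (fun i => (A (p i).1, (p i).2)) (fun i => hp i)).congr (fun δ => ?_)
    exact congrArg P (funext fun i => disc_genBall_map_eq_of_meshPos σ A hA δ (p i))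
  -- … which by the lattice symmetry of `P` is the family at the original configuration
  have h2 : Tendsto (fun δ : ℝ => P (fun i => {x : Site d | σ.symm x ∈ {y : Site d | meshPos δ y ∈
        (if 0 < (p i).2 then Metric.closedBall (p i).1 (p i).2
          else (Metric.ball (p i).1 (-(p i).2))ᶜ)}})) (𝓝[>] 0) (𝓝 (lam p)) := by
    refine (hlim p hp).congr (fun δ => ?_)
    exact (hP _).symm
  exact tendsto_nhds_unique h1 h2

/-- **`B_d`-invariance of scaling limits from `B_d`-invariance on the lattice**: the glue
`scalingLimit_map_eq_of_latticeSymmetry` for a signed coordinate permutation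
`σ = Site.signedPerm π ε` of `ℤ^d` and its isometry `A = signedPermIsometry π⁻¹ ε` of `ℝ^d`
(`signedPermIsometry_meshPos`): any full-filter scaling limit, over discretised generalised balls,
of a `σ`-invariant lattice functional `P` is `A`-invariant. [folklore] -/
theorem scalingLimit_signedPermIsometry_eq {m : ℕ} (P : (Fin m → Set (Site d)) → ℝ)
    (π : Equiv.Perm (Fin d)) (ε : Fin d → ℤˣ)
    (hP : ∀ K : Fin m → Set (Site d), P (fun i => {x | (Site.signedPerm π ε).symm x ∈ K i}) = P K)
    (lam : (Fin m → EuclideanSpace ℝ (Fin d) × ℝ) → ℝ)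
    (hlim : ∀ p : Fin m → EuclideanSpace ℝ (Fin d) × ℝ, (∀ i, (p i).2 ≠ 0) →
      Tendsto (fun δ : ℝ => P (fun i => {x : Site d | meshPos δ x ∈
        (if 0 < (p i).2 then Metric.closedBall (p i).1 (p i).2
          else (Metric.ball (p i).1 (-(p i).2))ᶜ)})) (𝓝[>] 0) (𝓝 (lam p)))
    (p : Fin m → EuclideanSpace ℝ (Fin d) × ℝ) (hp : ∀ i, (p i).2 ≠ 0) :
    lam (fun i => (signedPermIsometry π.symm ε (p i).1, (p i).2)) = lam p :=
  scalingLimit_map_eq_of_latticeSymmetry P (Site.signedPerm π ε) (signedPermIsometry π.symm ε)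
    (fun z δ => signedPermIsometry_meshPos π ε δ z) hP lam hlim p hp

/-- **Every full-filter scaling limit of the wired box connection laws of the random-cluster model
on `ℤ^d` is invariant under the hyperoctahedral group.** For `0 ≤ p ≤ 1`, `0 < q`, let
`P K = limUnder_{L → ∞} φ¹_{Λ_L,p,q}(rel_K ∈ R)` be the thermodynamic-limit value (a junk value where
the limit fails to exist) of the probability that the open-path connection relation among the
probes `K i` lies in `R`. If `P` of the mesh-`δ` discretised generalised balls with data
`(cᵢ, rᵢ)ᵢ` converges along `δ → 0⁺` to `lam (cᵢ, rᵢ)ᵢ` at every nonzero-radius configuration,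
then `lam (A cᵢ, rᵢ)ᵢ = lam (cᵢ, rᵢ)ᵢ` for each of the `2^d · d!` signed coordinate permutations
`A = signedPermIsometry π⁻¹ ε` (`limUnder_rcMeasure_real_connRelLaw_box_signedPerm` +
`scalingLimit_signedPermIsometry_eq`). Invariance under a general `A ∈ O(d)` (isotropy) is a
different matter — open for the critical models in `d = 3`. [folklore] -/
theorem connRelLaw_scalingLimit_signedPermIsometry_eq {p q : ℝ} (hp : p ∈ Set.Icc (0 : ℝ) 1)
    (hq : 0 < q) {m : ℕ} (R : Set (Fin m → Fin m → Prop))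
    (lam : (Fin m → EuclideanSpace ℝ (Fin d) × ℝ) → ℝ)
    (hlim : ∀ c : Fin m → EuclideanSpace ℝ (Fin d) × ℝ, (∀ i, (c i).2 ≠ 0) →
      Tendsto (fun δ : ℝ => limUnder atTop (fun L : ℕ =>
        (rcMeasure (finsetGraph (zdGraph d) (box d L)) p q (wiredBoundary (zdGraph d) (box d L))).real
          {ω | (fun i j => ∃ x y : ↥(box d L),
            x.1 ∈ {z : Site d | meshPos δ z ∈ (if 0 < (c i).2 then Metric.closedBall (c i).1 (c i).2
              else (Metric.ball (c i).1 (-(c i).2))ᶜ)} ∧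
            y.1 ∈ {z : Site d | meshPos δ z ∈ (if 0 < (c j).2 then Metric.closedBall (c j).1 (c j).2
              else (Metric.ball (c j).1 (-(c j).2))ᶜ)} ∧
            (openGraph ω).Reachable x y) ∈ R})) (𝓝[>] 0) (𝓝 (lam c)))
    (c : Fin m → EuclideanSpace ℝ (Fin d) × ℝ) (hc : ∀ i, (c i).2 ≠ 0)
    (π : Equiv.Perm (Fin d)) (ε : Fin d → ℤˣ) :
    lam (fun i => (signedPermIsometry π.symm ε (c i).1, (c i).2)) = lam c :=
  scalingLimit_signedPermIsometry_eq
    (fun K => limUnder atTop (fun L : ℕ =>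
      (rcMeasure (finsetGraph (zdGraph d) (box d L)) p q (wiredBoundary (zdGraph d) (box d L))).real
        {ω | (fun i j => ∃ x y : ↥(box d L), x.1 ∈ K i ∧ y.1 ∈ K j ∧
          (openGraph ω).Reachable x y) ∈ R}))
    π ε (fun K => limUnder_rcMeasure_real_connRelLaw_box_signedPerm π ε hp hq K R) lam hlim c hc

end Continuum

end Literature.Probability.LatticeModels
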